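import Summits.RiemannHypothesis.RiemannHypothesis.Theorems.PfPersistenceFfHandover
import Summits.RiemannHypothesis.RiemannHypothesis.Theorems.MotivicDoorFfDialDensity

/-!
# Motivic door, function-field side (C)(i), part 5a: THE EXACT FIBRE of a window prefix
(pub-rhdoor seat ff-1.  HONEST FRAMING: lottery ticket at the motivic door; RH probability negligible; consolation
prizes are real: a new semi-local Weil-positivity theorem, or a located gap in the Connes–Consani programme, plus the
ff-door theorem.  No claim about `ζ`; "RH(q,h)" is `|α| = √q` for the complex roots of ONE integer polynomial `h`.)

Parts 2 and 4 matched every finite-window reader by fakes from ONE honest family (the dial line, rank 1), and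
ffmirror-2's handover (`PfPersistenceFfHandover`) located the depth `g` at which one window pins an honest datum.
Parts 5a (this file) and 5b (`MotivicDoorFfFibreLattice`) compute the WHOLE picture below that depth — the exact
fibre of the window map and its density of fakes — all PROVED, no data:

* §1 WINDOWS = TOP COEFFICIENTS (plain form, monic data of one degree `d`, known `q > 0`):
  `T_M(q,h) = T_M(q,h')  ⇔  c_{d-k}(h) = c_{d-k}(h')` for all `k ≤ M` (`weilWindowForm_eq_iff_coeff_eq`;
  ⇒ is Newton via `esymm_eq_of_ffWindowForm_eq` + Vieta, ⇐ is ffmirror-1's `weilWindowForm_eq_of_coeff_eq`);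
  a window contains every shallower one (`weilWindowForm_eq_of_le`), so "the prefix `T_0,…,T_M` agrees" is
  "`T_M` agrees" (`weilTowerPrefix_eq_iff`), and the GRADED HANDOVER `T_{M+1} ⇔ T_M ∧ c_{d-M-1}`
  (`weilWindowForm_succ_eq_iff`): each deeper window hands over exactly one further coefficient.
* §2 READERS = PREDICATES OF THE TOP COEFFICIENTS: a depth-`M` window-local reader cannot separate two monic data
  of the same degree with the same top-`M` coefficients (`finiteWindow_reader_coeff`), and conversely every
  predicate of the top-`M` coefficients IS a depth-`M` window-local reader
  (`exists_finiteWindowReader_of_coeffPredicate`).  This is the quantifier form of "window-local predicate" in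
  door (i): at depth `M`, "functional of the windows `T_0, …, T_M`" = "predicate of `(c_{d-1}, …, c_{d-M})`".
* §3 FINITELY MANY RH-TRUE DATA of fixed `(q, g)` (`setOf_ffRH_finite`): RH puts every coefficient in the Weil
  box `|c_k| ≤ C(2g,k) q^{(2g-k)/2}` (part 4, `abs_coeff_le_of_ffRH`).  [context, not used: the asymptotic count of
  such isogeny-class polynomials is DiPippo–Howe, J. Number Theory 73 (1998), Thm 1.1.]

All statements are about integer polynomials and finite Toeplitz matrices; [folklore] throughout (Newton, Vieta).
Nothing here is, or implies, a statement about `ζ`.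
-/

set_option linter.dupNamespace false

noncomputable section

open Polynomial

open Summit.RiemannHypothesis.RiemannHypothesis.Theorems.PfPersistence.FfAngleTwin

namespace Summit.RiemannHypothesis.RiemannHypothesis.Theorems.MotivicDoor.FunctionField

/-! ## 1. Windows = top coefficients (plain form) -/

/-- Vieta, top-indexed: for monic `h` of degree `d` and `k ≤ d`, `c_{d-k}(h) = (-1)^k e_k(roots)` in `ℂ`.
[folklore] -/
theorem cast_coeff_sub_eq_esymm {h : ℤ[X]} (hh : h.Monic) {k : ℕ} (hk : k ≤ h.natDegree) :
    ((h.coeff (h.natDegree - k) : ℤ) : ℂ) = (-1) ^ k * (frobRoots h).esymm k := by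
  have e1 := Polynomial.coeff_eq_esymm_roots_of_card (card_roots_map_of_monic hh)
    (k := h.natDegree - k) (by rw [hh.natDegree_map]; exact Nat.sub_le _ _)
  rw [(hh.map _).leadingCoeff, hh.natDegree_map, Nat.sub_sub_self hk, one_mul, Polynomial.coeff_map,
    eq_intCast] at e1
  exact e1

/-- WINDOWS ⇒ TOP COEFFICIENTS: at known `q > 0`, `T_M(q,h) = T_M(q,h')` for monic `h, h'` forces
`c_{d-k}(h) = c_{d'-k}(h')` for every `k ≤ M` (and `d = d'`, Handover). [folklore] -/
theorem coeff_eq_of_weilWindowForm_eq {q : ℝ} (hq : 0 < q) {h h' : ℤ[X]} (hh : h.Monic)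
    (hh' : h'.Monic) {M : ℕ} (hT : weilWindowForm q h M = weilWindowForm q h' M) {k : ℕ} (hk : k ≤ M)
    (hkd : k ≤ h.natDegree) : h.coeff (h.natDegree - k) = h'.coeff (h'.natDegree - k) := by
  have hdeg : h.natDegree = h'.natDegree := natDegree_eq_of_weilWindowForm_eq hh hh' hT
  have e1 := cast_coeff_sub_eq_esymm hh hkd
  rw [esymm_eq_of_ffWindowForm_eq hq hT k hk, ← cast_coeff_sub_eq_esymm hh' (by omega)] at e1
  exact_mod_cast e1

/-- THE EXACT FIBRE OF A WINDOW (plain form): for monic `h, h'` of the same degree `d` and known `q > 0`,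
`T_M(q,h) = T_M(q,h')  ⇔  c_{d-k}(h) = c_{d-k}(h')` for all `k ≤ M`.  The window sees exactly the top `M`
coefficients — nothing less (Newton), nothing more (ffmirror-1's dial prefix). [folklore] -/
theorem weilWindowForm_eq_iff_coeff_eq {q : ℝ} (hq : 0 < q) {h h' : ℤ[X]} (hh : h.Monic)
    (hh' : h'.Monic) (hdeg : h.natDegree = h'.natDegree) (M : ℕ) :
    weilWindowForm q h M = weilWindowForm q h' M ↔
      ∀ k, k ≤ M → k ≤ h.natDegree → h.coeff (h.natDegree - k) = h'.coeff (h.natDegree - k) := by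
  refine ⟨fun hT k hkM hkd => ?_, fun hc => weilWindowForm_eq_of_coeff_eq q hh hh' hdeg
    (fun k _ hkM hkd => hc k hkM hkd) le_rfl⟩
  rw [coeff_eq_of_weilWindowForm_eq hq hh hh' hT hkM hkd, hdeg]

/-- A window contains every shallower window as its top-left block (any `q`, any multisets). [folklore] -/
theorem ffWindowForm_eq_of_le {q : ℝ} {A A' : Multiset ℂ} {M M' : ℕ} (hM : M' ≤ M)
    (hT : ffWindowForm q A M = ffWindowForm q A' M) : ffWindowForm q A M' = ffWindowForm q A' M' := by
  ext i j
  have hi := i.isLt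
  have hj := j.isLt
  have h : ffWindowForm q A M ⟨i.val, by omega⟩ ⟨j.val, by omega⟩
      = ffWindowForm q A' M ⟨i.val, by omega⟩ ⟨j.val, by omega⟩ := by rw [hT]
  simpa only [ffWindowForm, Matrix.of_apply] using h

/-- … in particular for the window forms of data `(q, h)`. [folklore] -/
theorem weilWindowForm_eq_of_le {q : ℝ} {h h' : ℤ[X]} {M M' : ℕ} (hM : M' ≤ M)
    (hT : weilWindowForm q h M = weilWindowForm q h' M) :
    weilWindowForm q h M' = weilWindowForm q h' M' :=
  ffWindowForm_eq_of_le hM hT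

/-- Hence agreement of the window PREFIX `(T_0, …, T_M)` is agreement of `T_M` alone. [folklore] -/
theorem weilTowerPrefix_eq_iff {q : ℝ} {h h' : ℤ[X]} (M : ℕ) :
    (∀ M' ≤ M, weilWindowTower q h M' = weilWindowTower q h' M') ↔
      weilWindowForm q h M = weilWindowForm q h' M :=
  ⟨fun H => H M le_rfl, fun hT _ hM' => weilWindowForm_eq_of_le hM' hT⟩

/-- GRADED HANDOVER: for monic `h, h'` of the same degree `d` and `q > 0`,
`T_{M+1}(q,h) = T_{M+1}(q,h')  ⇔  T_M(q,h) = T_M(q,h') ∧ c_{d-M-1}(h) = c_{d-M-1}(h')` (the last conjunct only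
while `M + 1 ≤ d`): each deeper window hands over exactly ONE further coefficient. [folklore] -/
theorem weilWindowForm_succ_eq_iff {q : ℝ} (hq : 0 < q) {h h' : ℤ[X]} (hh : h.Monic) (hh' : h'.Monic)
    (hdeg : h.natDegree = h'.natDegree) (M : ℕ) :
    weilWindowForm q h (M + 1) = weilWindowForm q h' (M + 1) ↔
      weilWindowForm q h M = weilWindowForm q h' M ∧
        (M + 1 ≤ h.natDegree → h.coeff (h.natDegree - (M + 1)) = h'.coeff (h.natDegree - (M + 1))) := by
  rw [weilWindowForm_eq_iff_coeff_eq hq hh hh' hdeg, weilWindowForm_eq_iff_coeff_eq hq hh hh' hdeg]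
  constructor
  · intro H
    exact ⟨fun k hkM hkd => H k (Nat.le_succ_of_le hkM) hkd, fun hMd => H (M + 1) le_rfl hMd⟩
  · rintro ⟨H, hc⟩ k hk hkd
    rcases Nat.lt_or_ge k (M + 1) with hlt | hge
    · exact H k (Nat.lt_succ_iff.mp hlt) hkd
    · obtain rfl : k = M + 1 := le_antisymm hk hge
      exact hc hkd

/-- Re-indexed form used below: for monic `h, h'` of degree `2g`, `T_M(q,h') = T_M(q,h)` iff the coefficients
`c_i`, `i ≥ 2g - M`, agree. [folklore] -/
theorem weilWindowForm_eq_iff_coeff_eq_top {q : ℝ} (hq : 0 < q) {h h' : ℤ[X]} {g : ℕ} (hh : h.Monic)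
    (hh' : h'.Monic) (hdeg : h.natDegree = 2 * g) (hdeg' : h'.natDegree = 2 * g) (M : ℕ) :
    weilWindowForm q h' M = weilWindowForm q h M ↔ ∀ i, 2 * g - M ≤ i → h'.coeff i = h.coeff i := by
  rw [weilWindowForm_eq_iff_coeff_eq hq hh' hh (hdeg'.trans hdeg.symm) M, hdeg']
  constructor
  · intro H i hi
    by_cases hi2 : i ≤ 2 * g
    · have e := H (2 * g - i) (by omega) (by omega)
      rwa [show 2 * g - (2 * g - i) = i by omega] at e
    · rw [coeff_eq_zero_of_natDegree_lt (by omega), coeff_eq_zero_of_natDegree_lt (by omega)]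
  · intro H k hkM _
    exact H (2 * g - k) (by omega)

/-! ## 2. Window-local readers = predicates of the top coefficients -/

/-- A depth-`M` window-local reader cannot separate two monic data of the same degree (same `q > 0`) whose top
`M` coefficients agree. [folklore] -/
theorem finiteWindow_reader_coeff {Φ : Tower → Prop} {M : ℕ}
    (hloc : ∀ T T' : Tower, (∀ M' ≤ M, T M' = T' M') → Φ T → Φ T')
    {q : ℝ} (hq : 0 < q) {h h' : ℤ[X]} (hh : h.Monic) (hh' : h'.Monic) (hdeg : h.natDegree = h'.natDegree)
    (hc : ∀ k, k ≤ M → k ≤ h.natDegree → h.coeff (h.natDegree - k) = h'.coeff (h.natDegree - k)) :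
    Φ (weilWindowTower q h) ↔ Φ (weilWindowTower q h') := by
  have hT := (weilWindowForm_eq_iff_coeff_eq hq hh hh' hdeg M).2 hc
  exact ⟨hloc _ _ fun M' hM' => weilWindowForm_eq_of_le hM' hT,
    hloc _ _ fun M' hM' => (weilWindowForm_eq_of_le hM' hT).symm⟩

/-- Conversely EVERY predicate `P` of monic degree-`d` data that depends only on the top `M` coefficients is a
depth-`M` window-local reader (at known `q > 0`).  So "window-local predicate of depth `M`" and "predicate of
`(c_{d-1}, …, c_{d-M})`" are the same notion — the quantifier form of door (i). [folklore] -/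
theorem exists_finiteWindowReader_of_coeffPredicate {q : ℝ} (hq : 0 < q) (d M : ℕ) (P : ℤ[X] → Prop)
    (hP : ∀ h h' : ℤ[X], h.Monic → h'.Monic → h.natDegree = d → h'.natDegree = d →
      (∀ k, k ≤ M → k ≤ d → h.coeff (d - k) = h'.coeff (d - k)) → P h → P h') :
    ∃ Φ : Tower → Prop, (∀ T T' : Tower, (∀ M' ≤ M, T M' = T' M') → Φ T → Φ T') ∧
      ∀ h : ℤ[X], h.Monic → h.natDegree = d → (Φ (weilWindowTower q h) ↔ P h) := by
  refine ⟨fun T => ∃ h' : ℤ[X], h'.Monic ∧ h'.natDegree = d ∧ P h' ∧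
    ∀ M' ≤ M, T M' = weilWindowTower q h' M', ?_, ?_⟩
  · rintro T T' hTT' ⟨h', hh', hdeg', hP', hT⟩
    exact ⟨h', hh', hdeg', hP', fun M' hM' => (hTT' M' hM').symm.trans (hT M' hM')⟩
  · intro h hh hdeg
    constructor
    · rintro ⟨h', hh', hdeg', hP', hT⟩
      have hTM : weilWindowForm q h' M = weilWindowForm q h M := ((weilTowerPrefix_eq_iff M).1 hT).symm
      refine hP h' h hh' hh hdeg' hdeg (fun k hkM hkd => ?_) hP'
      have e := (weilWindowForm_eq_iff_coeff_eq hq hh' hh (hdeg'.trans hdeg.symm) M).1 hTM k hkM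
        (by omega)
      rwa [hdeg'] at e
    · intro hPh
      exact ⟨h, hh, hdeg, hPh, fun M' _ => rfl⟩

/-! ## 3. Finitely many RH-true data of fixed `(q, g)` -/

/-- FINITENESS OF RH-TRUE DATA: for fixed `q` and `g`, only finitely many monic `h ∈ ℤ[x]` of degree `2g` have
all roots on `|α| = √q` — RH confines every coefficient to the Weil box `|c_k| ≤ C(2g,k) q^{(2g-k)/2}`
(part 4).  [folklore; the asymptotic COUNT is DiPippo–Howe 1998, Thm 1.1 — cited for context, not used] -/
theorem setOf_ffRH_finite (q g : ℕ) :
    {h : ℤ[X] | h.Monic ∧ h.natDegree = 2 * g ∧ ∀ α ∈ frobRoots h, ‖α‖ = Real.sqrt q}.Finite := by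
  let B : Fin (2 * g + 1) → ℤ := fun k => ⌈((2 * g).choose k : ℝ) * Real.sqrt q ^ (2 * g - k)⌉
  refine Set.Finite.of_finite_image (f := fun h : ℤ[X] => fun k : Fin (2 * g + 1) => h.coeff k) ?_ ?_
  · refine (Set.Finite.pi fun k : Fin (2 * g + 1) => Set.finite_Icc (-B k) (B k)).subset ?_
    rintro v ⟨h, ⟨hh, hdeg, hRH⟩, rfl⟩
    simp only [Set.mem_univ_pi, Set.mem_Icc]
    intro k
    have hb := abs_le.1 (abs_coeff_le_of_ffRH hh hdeg hRH (k := (k : ℕ)) (Nat.le_of_lt_succ k.isLt))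
    have hB : ((2 * g).choose (k : ℕ) : ℝ) * Real.sqrt q ^ (2 * g - k) ≤ (B k : ℝ) := Int.le_ceil _
    constructor
    · have : ((-B k : ℤ) : ℝ) ≤ (h.coeff k : ℝ) := by push_cast; linarith [hb.1, hB]
      exact_mod_cast this
    · have : ((h.coeff k : ℤ) : ℝ) ≤ (B k : ℝ) := hb.2.trans hB
      exact_mod_cast this
  · rintro h ⟨-, hdeg, -⟩ h' ⟨-, hdeg', -⟩ hv
    ext k
    by_cases hk : k ≤ 2 * g
    · exact congrFun hv ⟨k, Nat.lt_succ_of_le hk⟩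
    · rw [coeff_eq_zero_of_natDegree_lt (by omega), coeff_eq_zero_of_natDegree_lt (by omega)]

end Summit.RiemannHypothesis.RiemannHypothesis.Theorems.MotivicDoor.FunctionField

end
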